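import Literature.MathematicalPhysics.QuantumFieldTheory.Balaban1983to89.B9QstarLettersAtPins

/-!
# `Balaban1983to89.B9QLettersAtPins` — THE KINEMATIC LETTER `Q(U)` AT THE PINS, EVERY REGULAR `U`: node00-def-Y's coordinate model `QcoKH` of the
# covariant averaging operator is LOCAL (radius `ℓ + 4`) and a SUP-NORM CONTRACTION at every gauge-group-valued configuration; the letters
# `Letters313Z.q2 ∕ q1` (`Q(U) : 𝔠⁽ᵖ⁾ → 𝔠_Z⁽ᵖ⁾`) of the N06 certificate hold at the pins, uniformly on the k-level census (block-L² twin: the sequel `B9QLettersAtPinsL2`)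

T. Bałaban, *Propagators for lattice gauge theories in a background field*, Commun. Math. Phys. **99** (1985) 389–434
[`Balaban1985BackgroundPropagators`, "B9"]; [4] = T. Bałaban, *Propagators and renormalization transformations for lattice gauge
theories. II*, Commun. Math. Phys. **96** (1984) 223–250 [`Balaban1984PropagatorsII`]; [3] = part I, Commun. Math. Phys. **95** (1984) 17–40
[`Balaban1984PropagatorsI`].

statement-level skeleton of published theorems with citation tags; proofs where landed; nothing here is a claim about the Yang–Mills
mass gap

THE PRINTED LOCI.  [B9] (3.12)–(3.14) p. 393 (the covariant averaging `Q(U)`: the fine bond `b` of a straight contour is transported to the initial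
point of the coarse bond along the contour transporter), (3.13) (*"Q\* the adjoint of Q"*), (3.110) p. 417 (normalisation), (3.35) p. 396 (*"U has values
in G"*), p. 398 (remark after (3.47): the powers of `Lʲη` may be split between the blocks), Thm 3.13 p. 426 (the letters of the reduction); [3] (1.18) p. 20
(`0 ≤ q_y(f) ≤ L^{−j(d+1)}`, `Σ_f q_y(f) = 1`); [4] Lemma 2.1 (2.60) p. 234, (2.51) p. 232.

THE POINT (cell `pub-ymgap`, node N06; width seat w5, CLAIM-2 ∕ INTENT-2 2026-08-28).  dag-n06-w3's `B9Letters313AtOneQ.hasMaj_Q_one` inhabits the displayed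
fields `Letters313Z.q2 ∕ q1` of the N06 certificate's `hletters13` AT `U = 1` ONLY (the flat kernel read through n06-d's `liftY` functor).  The predecessor
files `B9QstarLettersAtPins(L2)` treat `Q*(U)` at EVERY contracting `U`; THIS FILE does the same for `Q(U)` itself — def-Y's `QcoKH i b B cfg parB U₁ =
(cR39 b)⁻¹ • coordOpKH b (Q(U))`, `Q(U) = trLiftY qK (qT parB U)` (the certificate's pin `hQco12`):
* §1 ★ `abs_QcoKH_apply_le` — at an input localised at the fine block `y′`, `|(QF)(y, ν, c, c′)| ≤ (cR39 b)⁻¹·coordBound·basisBound·Σ_f q_y(f)·Σ_a|F(f, ν, a, c′)|`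
  (the transporters are norm contractions; the coordinates are read by n06-d's `abs_repr_le ∕ norm_sum_smul_basis_le`);
* §2 ★★ `hasMajorantHom_QcoKH` — `Q(U₁)` from `XBK` (block map `blkBK bI`, `bI` 1-faithful) to `XHK` (`blkHK`) has the [4]-(2.51) majorant `e^{δ(ℓ+4)}·e^{−δd}` for
  every `δ ≥ 0` (total mass one ⇒ sup-norm contraction; support radius `ℓ + 4` = n06-w3's `dist_le_of_qwt_ne_zero_bI`) — the all-`U` twin of n06-w3's
  `hasMajorantHom_QcoKH_one`; ★★ `hasMaj_QcoKH` — the class form `Q(U₁) : 𝔠⁽ᵖ⁾ → 𝔠_Z⁽ᵖ⁾` with majorant `Lᵖ·e^{2ε(ℓ+4)}·e^{−εd}` above the (2.60) threshold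
  `p·log L ≤ ε(2L² − 1)M` (= the fields `q2 ∕ q1`, n06-w3's transfer argument verbatim); `hasMaj_Q_of_pins` — the letter-record form (pins `hblk ∕ hblkZ ∕ hQ`);
* §3 at def-Y's members (`trBasis N`, `parBY`, `SU(N)`-valued regular `U`): ★★ `hasMaj_Q_pins` (`q2 ∕ q1`) and `dotProduct_QcoKH_eq` (`Q*` is the adjoint of `Q`
  for the dot products, def-Y's `isTransposePair_QcoKH_QscoKH`) — the block-L² letter `Letters313L2PZ.q` follows by transposition in the sequel `B9QLettersAtPinsL2`.

HONEST SCOPE.  Finite-dimensional lattice bookkeeping for ONE kinematic letter; nothing of [B9]'s propagator estimates is asserted; inputs cited by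
name (r03 `qwt_nonneg ∕ qwt_le ∕ sum_qwt_eq_one`, n06-w3 `dist_le_of_qwt_ne_zero_bI ∕ len_pow_le_of_transfer`, n06-d's coordinate dictionary, def-Y's
`parBY_mem ∕ isTransposePair_QcoKH_QscoKH`).  A helper for the N06 certificate; COUNT-NEUTRAL; N06 is NOT discharged; one
finite lattice at a time; nothing continuum, nothing about the mass gap ∕ Clay.  Cell `pub-ymgap` (HUMAN RULING D-0062 ∕ D-0154), Track A node N06
[B9], width seat `pub-ymgap-dag-n06-w5` (g0), 2026-08-28.
-/

noncomputable section

namespace Literature.MathematicalPhysics.QuantumFieldTheory.Balaban1983to89.B9QLettersAtPins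

open B6Geom246MultiLevelTorus (geomT)
open B6GlobalChartV1 (PV blkV1)
open B6KLevelCensusIndexV1 (KIdx)
open B6RandomWalk (BlockSupp)
open B6RandomWalkHom (HasMajorantHom)
open B6Ineq2142KLevelV1 (lvl β qwt qwt_nonneg qwt_le)
open B9Eq3132Ineq2142Covariant (qK_apply sum_qwt_eq_one)
open B9Eq39Adjoint (R R_zero)
open B9GeoNormsKLevelV1 (geo9K)
open B9GeoLemma21KLevelV1 (geo9K_dist_comm geo9K_len_pos geo9K_one_le_L)
open B9Thm39ReadingCoords (cR39 cR39_nonneg coordBound39 basisBound39 abs_repr_le norm_sum_smul_basis_le)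
open B9Thm34Ext (toB6)
open B11SectG (HasMaj BlockNorm)
open B9Thm312Whole (cNorm GeoOK Ops wt)
open B9Thm37Glue (IsTransposePair)
open B9CoReadingCoords (assembleK XBK blkBK)
open B9CoReadingCoordsH (XHK blkHK coordOpKH_apply)
open B9Letters313AtOneQ (dist_le_of_qwt_ne_zero_bI len_pow_le_of_transfer)
open B9QstarLettersAtPins (reading_const_collapse parBY_norm_le_one_of_reg335)
open Node00 Node00.OpsYSectDCoords
open scoped Matrix

variable {d ℓ : ℕ} {hd : 1 ≤ d + 1} {hL : Odd (ℓ + 1) ∧ 1 < ℓ + 1} {b₀ b₁ : ℝ}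

/-! ## §1 The model `Q(U₁)` unfolded at a localised input; the pointwise bound -/

section Model

variable {𝔸 : Type} [NormedRing 𝔸] [NormedAlgebra ℂ 𝔸] [CompleteSpace 𝔸] [FiniteDimensional ℝ 𝔸]
variable {κ : Type} [Fintype κ]
variable (i : KIdx d ℓ hd hL b₀ b₁) (b : Module.Basis κ ℝ 𝔸) (B : B9.Backgrounds) (cfg : B.Cfg → CfgY 𝔸 i) (parB : BondParY 𝔸 i)

omit [NormedAlgebra ℂ 𝔸] [CompleteSpace 𝔸] [FiniteDimensional ℝ 𝔸] in
/-- A unit that is a norm contraction together with its inverse conjugates contractively: `‖g v g⁻¹‖ ≤ ‖v‖`. [folklore] -/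
private theorem norm_R_le_of_contraction {g : 𝔸ˣ} (h1 : ‖(g : 𝔸)‖ ≤ 1) (h2 : ‖((g⁻¹ : 𝔸ˣ) : 𝔸)‖ ≤ 1) (v : 𝔸) :
    ‖R g v‖ ≤ ‖v‖ := by
  unfold R
  calc ‖(g : 𝔸) * v * ((g⁻¹ : 𝔸ˣ) : 𝔸)‖ ≤ ‖(g : 𝔸) * v‖ * ‖((g⁻¹ : 𝔸ˣ) : 𝔸)‖ := norm_mul_le _ _
    _ ≤ (‖(g : 𝔸)‖ * ‖v‖) * ‖((g⁻¹ : 𝔸ˣ) : 𝔸)‖ := mul_le_mul_of_nonneg_right (norm_mul_le _ _) (norm_nonneg _)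
    _ ≤ (1 * ‖v‖) * 1 :=
        mul_le_mul (mul_le_mul_of_nonneg_right h1 (norm_nonneg _)) h2 (norm_nonneg _) (by positivity)
    _ = ‖v‖ := by ring

/-- ★ **THE MODEL `Q(U₁)`, UNFOLDED**: `(QF)(y, ν, c, c′) = (cR39 b)⁻¹ · repr_c (Σ_f q_y(f) • R(U(Γ_{y,f})) w_f)` with `w_f = Σ_a F(f, ν, a, c′)·b_a` the re-assembled
`(ν, ·, c′)`-slice at the fine bond `f` — the flat kernel `q_y(f)` of (3.12)–(3.14) and one transporter per fine bond.
[cite: Balaban1985BackgroundPropagators, (3.12)–(3.14) p.393; Balaban1984PropagatorsI, (1.18) p.20] -/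
theorem QcoKH_apply (U₁ : B.Cfg) (F : XBK κ i → ℝ) (q : XHK κ i) :
    QcoKH i b B cfg parB U₁ F q =
      (cR39 b)⁻¹ * b.repr (∑ f : FBondY i, ((qwt i.hN i.D i.hk q.1 f : ℝ) : ℂ) •
        R (qT i parB (cfg U₁) q.1 f) (assembleK b q.2.1 q.2.2.2 F f)) q.2.2.1 := by
  have hQ : QY i parB (cfg U₁) (assembleK b q.2.1 q.2.2.2 F) q.1 = ∑ f : FBondY i, ((qwt i.hN i.D i.hk q.1 f : ℝ) : ℂ) •
      R (qT i parB (cfg U₁) q.1 f) (assembleK b q.2.1 q.2.2.2 F f) := by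
    show trLiftY (qK i) (qT i parB (cfg U₁)) (assembleK b q.2.1 q.2.2.2 F) q.1 = _
    simp only [trLiftY_apply, qK_apply]
  simp only [QcoKH, LinearMap.smul_apply, Pi.smul_apply, smul_eq_mul, coordOpKH_apply, LinearMap.restrictScalars_apply, hQ]

/-- ★ **THE POINTWISE BOUND**: if every transporter `U(Γ)` and its inverse are norm contractions, then
`|(QF)(y, ν, c, c′)| ≤ (cR39 b)⁻¹ · coordBound · basisBound · Σ_f q_y(f) · Σ_a |F(f, ν, a, c′)|`.
[cite: Balaban1985BackgroundPropagators, (3.12)–(3.14) p.393, (3.42) p.397, dictionary; Balaban1984PropagatorsI, (1.18) p.20] -/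
theorem abs_QcoKH_apply_le (U₁ : B.Cfg)
    (hpar : ∀ s s', ‖(parB (cfg U₁) s s' : 𝔸)‖ ≤ 1 ∧ ‖(((parB (cfg U₁) s s')⁻¹ : 𝔸ˣ) : 𝔸)‖ ≤ 1) (F : XBK κ i → ℝ) (q : XHK κ i) :
    |QcoKH i b B cfg parB U₁ F q| ≤
      (cR39 b)⁻¹ * (coordBound39 b * (basisBound39 b *
        ∑ f : FBondY i, qwt i.hN i.D i.hk q.1 f * ∑ a, |F (f, q.2.1, a, q.2.2.2)|)) := by
  rw [QcoKH_apply i b B cfg parB U₁ F q]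
  have hc0 : 0 ≤ (cR39 b)⁻¹ := inv_nonneg.mpr (cR39_nonneg b)
  have hcb : 0 ≤ coordBound39 b := norm_nonneg _
  have hbb : 0 ≤ basisBound39 b := Finset.sum_nonneg fun _ _ => norm_nonneg _
  set S : 𝔸 := ∑ f : FBondY i, ((qwt i.hN i.D i.hk q.1 f : ℝ) : ℂ) • R (qT i parB (cfg U₁) q.1 f) (assembleK b q.2.1 q.2.2.2 F f)
    with hS
  -- the norm of the transported average: Σ_f q_y(f)·‖w_f‖
  have hterm : ∀ f : FBondY i, ‖((qwt i.hN i.D i.hk q.1 f : ℝ) : ℂ) • R (qT i parB (cfg U₁) q.1 f) (assembleK b q.2.1 q.2.2.2 F f)‖ ≤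
      qwt i.hN i.D i.hk q.1 f * (basisBound39 b * ∑ a, |F (f, q.2.1, a, q.2.2.2)|) := fun f => by
    rw [Complex.coe_smul, norm_smul, Real.norm_eq_abs, abs_of_nonneg (qwt_nonneg _ _ _ _ _)]
    refine mul_le_mul_of_nonneg_left ?_ (qwt_nonneg _ _ _ _ _)
    have hg1 : ‖(qT i parB (cfg U₁) q.1 f : 𝔸)‖ ≤ 1 := (hpar _ _).1
    have hg2 : ‖(((qT i parB (cfg U₁) q.1 f)⁻¹ : 𝔸ˣ) : 𝔸)‖ ≤ 1 := (hpar _ _).2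
    exact (norm_R_le_of_contraction hg1 hg2 _).trans (norm_sum_smul_basis_le b _)
  have hSn : ‖S‖ ≤ ∑ f : FBondY i, qwt i.hN i.D i.hk q.1 f * (basisBound39 b * ∑ a, |F (f, q.2.1, a, q.2.2.2)|) :=
    (norm_sum_le _ _).trans (Finset.sum_le_sum fun f _ => hterm f)
  have hrepr : |b.repr S q.2.2.1| ≤ coordBound39 b * ‖S‖ := abs_repr_le b S q.2.2.1
  rw [abs_mul, abs_of_nonneg hc0]
  refine mul_le_mul_of_nonneg_left (hrepr.trans (mul_le_mul_of_nonneg_left (hSn.trans (le_of_eq ?_)) hcb)) hc0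
  rw [Finset.mul_sum]
  exact Finset.sum_congr rfl fun f _ => by ring

end Model

/-! ## §2 The sup letters: `Q(U₁)` is a local contraction (two-space form); `Q(U₁) : 𝔠⁽ᵖ⁾ → 𝔠_Z⁽ᵖ⁾` (the fields `q2 ∕ q1`) -/

section Sup

variable {𝔸 : Type} [NormedRing 𝔸] [NormedAlgebra ℂ 𝔸] [CompleteSpace 𝔸] [FiniteDimensional ℝ 𝔸]
variable {κ : Type} [Fintype κ]
variable (i : KIdx d ℓ hd hL b₀ b₁) (b : Module.Basis κ ℝ 𝔸) (B : B9.Backgrounds) (cfg : B.Cfg → CfgY 𝔸 i) (parB : BondParY 𝔸 i)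
variable {bI : FBondY i → IBondY i}

/-- ★★ **`Q(U₁)` AT THE PINS IS A LOCAL SUP-NORM CONTRACTION, EVERY CONTRACTING `U₁`** (the all-`U` twin of n06-w3's `hasMajorantHom_QcoKH_one`): from the
fine bonds `XBK` (block map `blkBK bI`, `bI` 1-faithful) to the coarse bonds `XHK` (`blkHK`), majorant `e^{δ(ℓ+4)}·e^{−δd(y,y′)}` for every `δ ≥ 0` — weights
`q_y(f) ≥ 0` of total mass one, vanishing unless `d(y, bI f) ≤ ℓ + 4`, transporters contracting, reading constant collapsing.
[cite: Balaban1985BackgroundPropagators, (3.12)–(3.14) p.393, (3.110) p.417, (3.35) p.396, Thm 3.13 p.426 (the letter Q); Balaban1984PropagatorsI, (1.18) p.20; Balaban1984PropagatorsII, (2.51) p.232] -/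
theorem hasMajorantHom_QcoKH
    (hβ1 : ∀ f : FBondY i, (geomT i.D).dist (β i.hN i.D i.hk (bI f)) (blkV1 i.hN i.D f) ≤ 1) {U₁ : B.Cfg}
    (hpar : ∀ s s', ‖(parB (cfg U₁) s s' : 𝔸)‖ ≤ 1 ∧ ‖(((parB (cfg U₁) s s')⁻¹ : 𝔸ˣ) : 𝔸)‖ ≤ 1)
    {δ : ℝ} (hδ : 0 ≤ δ) (R₀ : ℝ) (H₀ : Prop) [Fintype (geo9K i).Site] :
    HasMajorantHom (g := toB6 (geo9K i) R₀ H₀) (blkBK i bI) (blkHK i) (QcoKH i b B cfg parB U₁)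
      (fun a a' => Real.exp (δ * ((ℓ : ℝ) + 4)) * Real.exp (-(δ * (geo9K i).dist a a'))) := by
  intro y' F Bμ hμ q
  change IBondY i at y'
  -- each slice sum is ≤ |κ|·B and vanishes off the block of y′
  have hslice : ∀ f : FBondY i, ∑ a, |F (f, q.2.1, a, q.2.2.2)| ≤ (Fintype.card κ : ℝ) * Bμ := fun f => by
    calc ∑ a, |F (f, q.2.1, a, q.2.2.2)| ≤ ∑ _a : κ, Bμ := Finset.sum_le_sum fun a _ => by
          by_cases hf : bI f = y'
          · exact hμ.bound (f, q.2.1, a, q.2.2.2) hf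
          · rw [hμ.off (f, q.2.1, a, q.2.2.2) hf, abs_zero]; exact hμ.nonneg
      _ = (Fintype.card κ : ℝ) * Bμ := by rw [Finset.sum_const, nsmul_eq_mul, Finset.card_univ]
  have hslice0 : ∀ f : FBondY i, bI f ≠ y' → ∑ a, |F (f, q.2.1, a, q.2.2.2)| = 0 := fun f hf =>
    Finset.sum_eq_zero fun a _ => by rw [hμ.off (f, q.2.1, a, q.2.2.2) hf, abs_zero]
  have hK0 : 0 ≤ Real.exp (δ * ((ℓ : ℝ) + 4)) * Real.exp (-(δ * (geo9K i).dist (blkHK i q) y')) := by positivity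
  have hpt := abs_QcoKH_apply_le i b B cfg parB U₁ hpar F q
  by_cases hnear : (geo9K i).dist q.1 y' ≤ (ℓ : ℝ) + 4
  · -- Σ_f q_y(f)·slice ≤ |κ|·B·Σ_f q_y(f) = |κ|·B, then the reading constant collapses
    have hsum : ∑ f : FBondY i, qwt i.hN i.D i.hk q.1 f * ∑ a, |F (f, q.2.1, a, q.2.2.2)| ≤ (Fintype.card κ : ℝ) * Bμ := by
      calc ∑ f : FBondY i, qwt i.hN i.D i.hk q.1 f * ∑ a, |F (f, q.2.1, a, q.2.2.2)|
          ≤ ∑ f : FBondY i, qwt i.hN i.D i.hk q.1 f * ((Fintype.card κ : ℝ) * Bμ) :=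
            Finset.sum_le_sum fun f _ => mul_le_mul_of_nonneg_left (hslice f) (qwt_nonneg _ _ _ _ _)
        _ = (Fintype.card κ : ℝ) * Bμ := by rw [← Finset.sum_mul, sum_qwt_eq_one i q.1, one_mul]
    have h1 : |QcoKH i b B cfg parB U₁ F q| ≤ Bμ := by
      refine hpt.trans (le_trans ?_ (reading_const_collapse b hμ.nonneg))
      exact mul_le_mul_of_nonneg_left (mul_le_mul_of_nonneg_left (mul_le_mul_of_nonneg_left hsum
        (Finset.sum_nonneg fun _ _ => norm_nonneg _)) (norm_nonneg _)) (inv_nonneg.mpr (cR39_nonneg b))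
    have hK1 : 1 ≤ Real.exp (δ * ((ℓ : ℝ) + 4)) * Real.exp (-(δ * (geo9K i).dist (blkHK i q) y')) := by
      rw [← Real.exp_add]
      refine Real.one_le_exp ?_
      change 0 ≤ δ * ((ℓ : ℝ) + 4) + -(δ * (geo9K i).dist q.1 y')
      nlinarith [mul_le_mul_of_nonneg_left hnear hδ]
    calc |QcoKH i b B cfg parB U₁ F q| ≤ 1 * Bμ := by rw [one_mul]; exact h1
      _ ≤ _ := mul_le_mul_of_nonneg_right hK1 hμ.nonneg
  · -- beyond the radius every term vanishes: q_y(f) ≠ 0 and bI f = y′ would put y within ℓ + 4 of y′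
    have hsum0 : ∑ f : FBondY i, qwt i.hN i.D i.hk q.1 f * ∑ a, |F (f, q.2.1, a, q.2.2.2)| = 0 := by
      refine Finset.sum_eq_zero fun f _ => ?_
      by_cases hf : bI f = y'
      · by_cases hq : qwt i.hN i.D i.hk q.1 f = 0
        · rw [hq, zero_mul]
        · exact absurd (hf ▸ dist_le_of_qwt_ne_zero_bI i hβ1 hq) hnear
      · rw [hslice0 f hf, mul_zero]
    rw [hsum0, mul_zero, mul_zero, mul_zero] at hpt
    exact hpt.trans (mul_nonneg hK0 hμ.nonneg)

/-- ★★ **THE LETTERS `q2 ∕ q1` AT THE PINS, EVERY CONTRACTING `U₁`** (the all-`U` twin of n06-w3's `hasMaj_Q_one`, same transfer argument): `Q(U₁) : 𝔠⁽ᵖ⁾ → 𝔠_Z⁽ᵖ⁾`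
with the majorant `Lᵖ·e^{2ε(ℓ+4)}·e^{−εd}` for every member above the [4] (2.60) threshold `p·log L ≤ ε(2L² − 1)M` — the local contraction of
`hasMajorantHom_QcoKH` plus the transfer of the class weight `(L^{j′}η)^{−p} ↦ (Lʲη)^{−p}` (n06-w3 `len_pow_le_of_transfer`).
[cite: Balaban1985BackgroundPropagators, Thm 3.13 p.426 (the letter Q, classes p → Zᵖ), (3.110) p.417, (3.42) p.397, p.398 (remark after (3.47)); Balaban1984PropagatorsI, (1.18) p.20; Balaban1984PropagatorsII, (2.51) p.232, (2.60) p.234] -/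
theorem hasMaj_QcoKH (hG : GeoOK (geo9K i)) [Fintype (geo9K i).Site]
    (hβ1 : ∀ f : FBondY i, (geomT i.D).dist (β i.hN i.D i.hk (bI f)) (blkV1 i.hN i.D f) ≤ 1) {U₁ : B.Cfg}
    (hpar : ∀ s s', ‖(parB (cfg U₁) s s' : 𝔸)‖ ≤ 1 ∧ ‖(((parB (cfg U₁) s s')⁻¹ : 𝔸ˣ) : 𝔸)‖ ≤ 1)
    {ε : ℝ} (hε : 0 < ε) (p : ℕ) (hM : (p : ℝ) * Real.log (geo9K i).L ≤ ε * (2 * ((ℓ : ℝ) + 1) ^ 2 - 1) * (geo9K i).M)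
    {R₀ : ℝ} {H₀ : Prop} :
    HasMaj (cNorm R₀ H₀ (blkBK i bI) hG.lenle p) (cNorm R₀ H₀ (blkHK i) hG.lenle p) (QcoKH i b B cfg parB U₁)
      (fun a a' => (geo9K i).L ^ p * Real.exp (2 * ε * ((ℓ : ℝ) + 4)) * Real.exp (-(ε * (geo9K i).dist a a'))) := by
  have h2ε : (0 : ℝ) ≤ 2 * ε := by positivity
  have hK := hasMajorantHom_QcoKH i b B cfg parB hβ1 hpar h2ε R₀ H₀
  have hK0 : ∀ a a' : (geo9K i).Site, 0 ≤ Real.exp (2 * ε * ((ℓ : ℝ) + 4)) * Real.exp (-(2 * ε * (geo9K i).dist a a')) :=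
    fun a a' => by positivity
  have h0 := B9Thm37AllNorms.hasMaj_of_hasMajorantHom (G := toB6 (geo9K i) R₀ H₀) (blkBK i bI) (blkHK i) hK0 hK
  refine (B9Thm312WholeLeaf.hasMaj_cNorm_of_hasMaj hG p p h0).mono fun y y' => ?_
  have ht := len_pow_le_of_transfer i hε p hM y y'
  have hly : 0 < (geo9K i).len y ^ p := pow_pos (hG.lenpos y) p
  have hw : wt (geo9K i) p y * (geo9K i).len y' ^ p ≤ (geo9K i).L ^ p * Real.exp (ε * (geo9K i).dist y y') := by
    rw [wt, inv_mul_le_iff₀ hly]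
    calc (geo9K i).len y' ^ p ≤ (geo9K i).L ^ p * Real.exp (ε * (geo9K i).dist y y') * (geo9K i).len y ^ p := ht
      _ = (geo9K i).len y ^ p * ((geo9K i).L ^ p * Real.exp (ε * (geo9K i).dist y y')) := by ring
  have hexp : Real.exp (-(2 * ε * (geo9K i).dist y y')) * Real.exp (ε * (geo9K i).dist y y') = Real.exp (-(ε * (geo9K i).dist y y')) := by
    rw [← Real.exp_add]; congr 1; ring
  calc Real.exp (2 * ε * ((ℓ : ℝ) + 4)) * Real.exp (-(2 * ε * (geo9K i).dist y y')) * wt (geo9K i) p y * (geo9K i).len y' ^ p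
      = Real.exp (2 * ε * ((ℓ : ℝ) + 4)) * Real.exp (-(2 * ε * (geo9K i).dist y y')) * (wt (geo9K i) p y * (geo9K i).len y' ^ p) := by ring
    _ ≤ Real.exp (2 * ε * ((ℓ : ℝ) + 4)) * Real.exp (-(2 * ε * (geo9K i).dist y y')) *
          ((geo9K i).L ^ p * Real.exp (ε * (geo9K i).dist y y')) := mul_le_mul_of_nonneg_left hw (hK0 y y')
    _ = (geo9K i).L ^ p * Real.exp (2 * ε * ((ℓ : ℝ) + 4)) *
          (Real.exp (-(2 * ε * (geo9K i).dist y y')) * Real.exp (ε * (geo9K i).dist y y')) := by ring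
    _ = _ := by rw [hexp]

/-- ★ **LETTER-RECORD FORM**: at any `B9Thm312Whole.Ops` record over `geo9K i` with carriers `XBK ∕ · ∕ XHK ∕ ·` whose block maps and `Q` at `U₁` are pinned to
n06-d's carriers and def-Y's model (the certificate's `hblk12 ∕ hblkZ12 ∕ hQco12`), the displayed letter `HasMaj (cNorm … 𝔬.blk _ p) (cNorm … 𝔬.blkZ _ p) (𝔬.Q U₁)
(Lᵖ·e^{2ε(ℓ+4)}·e^{−εd})` HOLDS above the (2.60) threshold. [cite: Balaban1985BackgroundPropagators, Thm 3.13 p.426 (the letter Q), (3.12)–(3.14) p.393; Balaban1984PropagatorsII, (2.51) p.232, (2.60) p.234] -/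
theorem hasMaj_Q_of_pins (hG : GeoOK (geo9K i)) [Fintype (geo9K i).Site] {Y W : Type} [Fintype Y] [Fintype W]
    (𝔬 : Ops (geo9K i) B (XBK κ i) Y (XHK κ i) W) (hblk : 𝔬.blk = blkBK i bI) (hblkZ : 𝔬.blkZ = blkHK i)
    {U₁ : B.Cfg} (hQ : 𝔬.Q U₁ = QcoKH i b B cfg parB U₁)
    (hβ1 : ∀ f : FBondY i, (geomT i.D).dist (β i.hN i.D i.hk (bI f)) (blkV1 i.hN i.D f) ≤ 1)
    (hpar : ∀ s s', ‖(parB (cfg U₁) s s' : 𝔸)‖ ≤ 1 ∧ ‖(((parB (cfg U₁) s s')⁻¹ : 𝔸ˣ) : 𝔸)‖ ≤ 1)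
    {ε : ℝ} (hε : 0 < ε) (p : ℕ) (hM : (p : ℝ) * Real.log (geo9K i).L ≤ ε * (2 * ((ℓ : ℝ) + 1) ^ 2 - 1) * (geo9K i).M)
    {R₀ : ℝ} {H₀ : Prop} :
    HasMaj (cNorm R₀ H₀ 𝔬.blk hG.lenle p) (cNorm R₀ H₀ 𝔬.blkZ hG.lenle p) (𝔬.Q U₁)
      (fun a a' => (geo9K i).L ^ p * Real.exp (2 * ε * ((ℓ : ℝ) + 4)) * Real.exp (-(ε * (geo9K i).dist a a'))) := by
  rw [hblk, hblkZ, hQ]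
  exact hasMaj_QcoKH i b B cfg parB hG hβ1 hpar hε p hM

end Sup

/-! ## §3 At node00-def-Y's members: the letters `q2 ∕ q1` of `Q(U)` at the certificate's pins, every regular `U`; `Q*` the adjoint of `Q` -/

section Members

open scoped Matrix.Norms.L2Operator
open B7Prop2SpecialUnitary (specialUnitaryUnits specialUnitaryUnits_le_unitaryUnits)
open B9PinMembersKLevelV1 (MemberY geo9Y bg9Y reg335Y_iff)
open B9BackgroundsKLevelV1 (mem_of_reg335)
open B9CoReadingCoordsTranspose (TrIdx trBasis)

variable {Mstar : ℕ} {N : ℕ} [NeZero N]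
variable [∀ x : MemberY d ℓ hd hL b₀ b₁ Mstar, Fintype (geo9Y x).Site]

/-- ★★ **THE LETTERS `q2 ∕ q1` AT THE CERTIFICATE'S PINS, EVERY MEMBER ABOVE THE (2.60) THRESHOLD, EVERY REGULAR `U`**: at
`QcoKH x.toKIdx (trBasis N) (bg9Y …) (fun U => U) (parBY x.toKIdx) U` (the pin `hQco12`), block maps `blkBK x.toKIdx bI` ∕ `blkHK x.toKIdx` (`hblk12 ∕ hblkZ12`):
`HasMaj (cNorm R₀ H₀ (blkBK bI) _ p) (cNorm R₀ H₀ blkHK _ p) (Q(U)) (Lᵖ·e^{2ε(ℓ+4)}·e^{−εd})`.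
[cite: Balaban1985BackgroundPropagators, Thm 3.13 p.426 (the letter Q), (3.12)–(3.14) p.393, (3.35) p.396; Balaban1984PropagatorsII, (2.51) p.232, (2.60) p.234] -/
theorem hasMaj_Q_pins (x : MemberY d ℓ hd hL b₀ b₁ Mstar) (hG : GeoOK (geo9Y x)) {bI : FBondY x.toKIdx → IBondY x.toKIdx}
    (hβ1 : ∀ f : FBondY x.toKIdx, (geomT x.D).dist (β x.hN x.D x.hk (bI f)) (blkV1 x.hN x.D f) ≤ 1) {c α₀ : ℝ}
    {U : (bg9Y (Matrix (Fin N) (Fin N) ℂ) (specialUnitaryUnits (Fin N)) x).Cfg}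
    (hU : (bg9Y (Matrix (Fin N) (Fin N) ℂ) (specialUnitaryUnits (Fin N)) x).Reg335 c α₀ U)
    {ε : ℝ} (hε : 0 < ε) (p : ℕ) (hM : (p : ℝ) * Real.log (geo9Y x).L ≤ ε * (2 * ((ℓ : ℝ) + 1) ^ 2 - 1) * (geo9Y x).M)
    {R₀ : ℝ} {H₀ : Prop} :
    HasMaj (cNorm R₀ H₀ (blkBK x.toKIdx bI) hG.lenle p) (cNorm R₀ H₀ (blkHK x.toKIdx) hG.lenle p)
      (QcoKH x.toKIdx (trBasis N) (bg9Y (Matrix (Fin N) (Fin N) ℂ) (specialUnitaryUnits (Fin N)) x) (fun U => U) (parBY x.toKIdx) U)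
      (fun a a' => (geo9Y x).L ^ p * Real.exp (2 * ε * ((ℓ : ℝ) + 4)) * Real.exp (-(ε * (geo9Y x).dist a a'))) := by
  letI : Fintype (geo9K x.toKIdx).Site := (inferInstance : Fintype (geo9Y x).Site)
  exact hasMaj_QcoKH x.toKIdx (trBasis N) (bg9Y (Matrix (Fin N) (Fin N) ℂ) (specialUnitaryUnits (Fin N)) x) (fun U => U)
    (parBY x.toKIdx) hG hβ1 (parBY_norm_le_one_of_reg335 x hU) hε p hM

omit [NeZero N] [∀ x : MemberY d ℓ hd hL b₀ b₁ Mstar, Fintype (geo9Y x).Site] in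
/-- `Q*` is the adjoint of `Q` at the pins for the dot products: `u ⬝ᵥ QF = Q*u ⬝ᵥ F` at an `SU(N)`-valued configuration (def-Y's
`isTransposePair_QcoKH_QscoKH` in `dotProduct` form). [cite: Balaban1985BackgroundPropagators, (3.13) p.393 («Q* the adjoint of Q»)] -/
theorem dotProduct_QcoKH_eq (x : MemberY d ℓ hd hL b₀ b₁ Mstar) {c α₀ : ℝ}
    {U : (bg9Y (Matrix (Fin N) (Fin N) ℂ) (specialUnitaryUnits (Fin N)) x).Cfg}
    (hU : (bg9Y (Matrix (Fin N) (Fin N) ℂ) (specialUnitaryUnits (Fin N)) x).Reg335 c α₀ U)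
    (u : XHK (TrIdx N) x.toKIdx → ℝ) (F : XBK (TrIdx N) x.toKIdx → ℝ) :
    u ⬝ᵥ QcoKH x.toKIdx (trBasis N) (bg9Y (Matrix (Fin N) (Fin N) ℂ) (specialUnitaryUnits (Fin N)) x) (fun U => U) (parBY x.toKIdx) U F =
      QscoKH x.toKIdx (trBasis N) (bg9Y (Matrix (Fin N) (Fin N) ℂ) (specialUnitaryUnits (Fin N)) x) (fun U => U) (parBY x.toKIdx) U u ⬝ᵥ F := by
  have hGv : ∀ μ z, U μ z ∈ specialUnitaryUnits (Fin N) := mem_of_reg335 x.toKIdx ((reg335Y_iff x c α₀ U).1 hU).1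
  have hT := isTransposePair_QcoKH_QscoKH x.toKIdx (bg9Y (Matrix (Fin N) (Fin N) ℂ) (specialUnitaryUnits (Fin N)) x) (fun U => U)
    (U₁ := U) specialUnitaryUnits_le_unitaryUnits hGv
  rw [dotProduct_comm u]
  show ∑ q, _ * u q = ∑ p, _ * F p
  rw [hT F u]
  exact Finset.sum_congr rfl fun p _ => mul_comm _ _

end Members

end Literature.MathematicalPhysics.QuantumFieldTheory.Balaban1983to89.B9QLettersAtPins

end
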